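import Summits.Ventures.LatticeQCDFlow.Scaling.ResolventLaw

/-!
HONEST FRAMING: exact (Metropolis-corrected) sampling algorithms for lattice gauge theory; figures
of merit are autocorrelation/cost numbers at stated couplings and volumes; no continuum-physics
claim.

# ResolventPartialSums — THE GEOMETRIC RESOLVENT AGAINST ITS TRUNCATIONS: `u − Σ_{j<n}σʲ(1−σ)νKʲ = σⁿ·uKⁿ`, HENCE `0 ≤ u(v) − Σ_{j<n}σʲ(1−σ)x_j(v) ≤ σⁿ` AND, FOR
# `0 ≤ f ≤ 1`, `E_u f − σⁿ ≤ Σ_{j<n}σʲ(1−σ)E_{x_j}f ≤ E_u f` (lean-2 GEN-43, ours)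

Venture-side (OURS).  Cell `lqcd-flow` (pub-lqcd), unit `pub-lqcd-lean-2-g43`, 2026-08-31.  Chapter AC, file 9 — a tool for the C2 ∕ C4 assembly.  Chapter W file 1
(`ResolventLaw`) treats the geometric resolvent `u = (1−σ)ν + σ·uK` through its equation only (no series).  The clock-conditioned step law (files 4–6) consumes, for every
truncation `n`, discounted PARTIAL sums `Σ_{j<n}σʲ(1−σ)·(functional of the j-step law x_j = νKʲ)`, while the certificates of chapters W–AC are stated for the resolvents.  The link,
still without series: the remainder `r_n = u − Σ_{j<n}σʲ(1−σ)x_j` obeys `r_0 = u`, `r_{n+1} = σ·r_nK`, so it is non-negative with total mass `σⁿ`.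

* `resolvent_partial_succ` (the truncation obeys `S_{n+1} = (1−σ)ν + σ·S_nK`), `resolvent_remainder_succ` (`r_{n+1} = σ·r_nK`), `resolvent_remainder_nonneg_sum`
  (`r_n ≥ 0`, `Σ_v r_n(v) = σⁿ`), **`resolvent_partial_le`** (`Σ_{j<n}σʲ(1−σ)x_j(v) ≤ u(v)`), **`resolvent_partial_ge`** (`u(v) − σⁿ ≤ Σ_{j<n}σʲ(1−σ)x_j(v)`),
  **`resolvent_partial_expect`** (`E_u f − σⁿ ≤ Σ_{j<n}σʲ(1−σ)E_{x_j}f ≤ E_u f` for `0 ≤ f ≤ 1`).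

Hypothesis-equations as in `ResolventLaw` (`K ≥ 0` with unit row sums, `0 ≤ σ < 1`, `ν` a probability vector, `u` a solution, `x_0 = ν`, `x_{j+1} = x_jK`).  Literature grade
(cell rule): OWN, elementary; nothing cited; no new bib keys.
-/

open Finset

namespace Summit.Ventures.LatticeQCDFlow.Scaling

section ResolventPartial
variable {S : Type*} [Fintype S]
variable {K : S → S → ℝ} {σ : ℝ} {ν u : S → ℝ} {x : ℕ → S → ℝ}

/-- **The truncation obeys the resolvent recursion:** `Σ_{j<n+1}σʲ(1−σ)x_j(v) = (1−σ)ν(v) + σ·Σ_h(Σ_{j<n}σʲ(1−σ)x_j(h))K(h,v)`. [ours] -/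
theorem resolvent_partial_succ (hx0 : ∀ v, x 0 v = ν v) (hxs : ∀ n v, x (n + 1) v = ∑ h, x n h * K h v) (n : ℕ) (v : S) :
    ∑ j ∈ range (n + 1), σ ^ j * (1 - σ) * x j v = (1 - σ) * ν v + σ * ∑ h, (∑ j ∈ range n, σ ^ j * (1 - σ) * x j h) * K h v := by
  rw [sum_range_succ', pow_zero, one_mul, hx0]
  have e : ∑ j ∈ range n, σ ^ (j + 1) * (1 - σ) * x (j + 1) v = σ * ∑ h, (∑ j ∈ range n, σ ^ j * (1 - σ) * x j h) * K h v := by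
    simp_rw [hxs, sum_mul, mul_sum]
    rw [sum_comm]
    exact sum_congr rfl fun j _ => sum_congr rfl fun h _ => by rw [pow_succ]; ring
  rw [e]; ring

/-- **The remainder obeys `r_{n+1} = σ·r_nK`** (`r_n = u − Σ_{j<n}σʲ(1−σ)x_j`). [ours] -/
theorem resolvent_remainder_succ (hu : ∀ v, u v = (1 - σ) * ν v + σ * ∑ h, u h * K h v)
    (hx0 : ∀ v, x 0 v = ν v) (hxs : ∀ n v, x (n + 1) v = ∑ h, x n h * K h v) (n : ℕ) (v : S) :
    u v - ∑ j ∈ range (n + 1), σ ^ j * (1 - σ) * x j v = σ * ∑ h, (u h - ∑ j ∈ range n, σ ^ j * (1 - σ) * x j h) * K h v := by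
  rw [resolvent_partial_succ hx0 hxs n v, hu v]
  have e : ∑ h, (u h - ∑ j ∈ range n, σ ^ j * (1 - σ) * x j h) * K h v
      = ∑ h, u h * K h v - ∑ h, (∑ j ∈ range n, σ ^ j * (1 - σ) * x j h) * K h v := by
    rw [← sum_sub_distrib]; exact sum_congr rfl fun h _ => by ring
  rw [e]; ring

/-- **The remainder is non-negative and has total mass `σⁿ`.** [ours] -/
theorem resolvent_remainder_nonneg_sum (hK0 : ∀ a b, 0 ≤ K a b) (hK1 : ∀ a, ∑ b, K a b = 1) (hσ0 : 0 ≤ σ) (hσ1 : σ < 1)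
    (hν0 : ∀ v, 0 ≤ ν v) (hν1 : ∑ v, ν v = 1) (hu : ∀ v, u v = (1 - σ) * ν v + σ * ∑ h, u h * K h v)
    (hx0 : ∀ v, x 0 v = ν v) (hxs : ∀ n v, x (n + 1) v = ∑ h, x n h * K h v) (n : ℕ) :
    (∀ v, 0 ≤ u v - ∑ j ∈ range n, σ ^ j * (1 - σ) * x j v) ∧ ∑ v, (u v - ∑ j ∈ range n, σ ^ j * (1 - σ) * x j v) = σ ^ n := by
  induction n with
  | zero =>
      refine ⟨fun v => ?_, ?_⟩
      · rw [sum_range_zero, sub_zero]; exact geomResolvent_nonneg hK0 hK1 hσ0 hσ1 hν0 hu v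
      · simp only [sum_range_zero, sub_zero, pow_zero]; rw [geomResolvent_sum hK1 hσ1.ne hu, hν1]
  | succ n ih =>
      obtain ⟨ih0, ihs⟩ := ih
      refine ⟨fun v => ?_, ?_⟩
      · rw [resolvent_remainder_succ hu hx0 hxs n v]
        exact mul_nonneg hσ0 (sum_nonneg fun h _ => mul_nonneg (ih0 h) (hK0 h v))
      · simp_rw [resolvent_remainder_succ hu hx0 hxs n]
        rw [← mul_sum, geomResolvent_mass_K hK1, ihs, pow_succ]; ring

/-- **`Σ_{j<n}σʲ(1−σ)x_j(v) ≤ u(v)`** (every truncation is below the resolvent). [ours] -/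
theorem resolvent_partial_le (hK0 : ∀ a b, 0 ≤ K a b) (hK1 : ∀ a, ∑ b, K a b = 1) (hσ0 : 0 ≤ σ) (hσ1 : σ < 1)
    (hν0 : ∀ v, 0 ≤ ν v) (hν1 : ∑ v, ν v = 1) (hu : ∀ v, u v = (1 - σ) * ν v + σ * ∑ h, u h * K h v)
    (hx0 : ∀ v, x 0 v = ν v) (hxs : ∀ n v, x (n + 1) v = ∑ h, x n h * K h v) (n : ℕ) (v : S) :
    ∑ j ∈ range n, σ ^ j * (1 - σ) * x j v ≤ u v := by
  have := (resolvent_remainder_nonneg_sum hK0 hK1 hσ0 hσ1 hν0 hν1 hu hx0 hxs n).1 v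
  linarith

/-- **`u(v) − σⁿ ≤ Σ_{j<n}σʲ(1−σ)x_j(v)`** (the remainder at a point is at most its total mass `σⁿ`). [ours] -/
theorem resolvent_partial_ge (hK0 : ∀ a b, 0 ≤ K a b) (hK1 : ∀ a, ∑ b, K a b = 1) (hσ0 : 0 ≤ σ) (hσ1 : σ < 1)
    (hν0 : ∀ v, 0 ≤ ν v) (hν1 : ∑ v, ν v = 1) (hu : ∀ v, u v = (1 - σ) * ν v + σ * ∑ h, u h * K h v)
    (hx0 : ∀ v, x 0 v = ν v) (hxs : ∀ n v, x (n + 1) v = ∑ h, x n h * K h v) (n : ℕ) (v : S) :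
    u v - σ ^ n ≤ ∑ j ∈ range n, σ ^ j * (1 - σ) * x j v := by
  classical
  obtain ⟨h0, hs⟩ := resolvent_remainder_nonneg_sum hK0 hK1 hσ0 hσ1 hν0 hν1 hu hx0 hxs n
  have hle : u v - ∑ j ∈ range n, σ ^ j * (1 - σ) * x j v ≤ ∑ w, (u w - ∑ j ∈ range n, σ ^ j * (1 - σ) * x j w) :=
    single_le_sum (fun w _ => h0 w) (mem_univ v)
  rw [hs] at hle
  linarith

/-- **Discounted partial expectations against the resolvent expectation:** for `0 ≤ f ≤ 1`, `E_u f − σⁿ ≤ Σ_{j<n}σʲ(1−σ)E_{x_j}f ≤ E_u f`. [ours] -/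
theorem resolvent_partial_expect (hK0 : ∀ a b, 0 ≤ K a b) (hK1 : ∀ a, ∑ b, K a b = 1) (hσ0 : 0 ≤ σ) (hσ1 : σ < 1)
    (hν0 : ∀ v, 0 ≤ ν v) (hν1 : ∑ v, ν v = 1) (hu : ∀ v, u v = (1 - σ) * ν v + σ * ∑ h, u h * K h v)
    (hx0 : ∀ v, x 0 v = ν v) (hxs : ∀ n v, x (n + 1) v = ∑ h, x n h * K h v) {f : S → ℝ} (hf0 : ∀ v, 0 ≤ f v) (hf1 : ∀ v, f v ≤ 1) (n : ℕ) :
    ∑ v, u v * f v - σ ^ n ≤ ∑ j ∈ range n, σ ^ j * (1 - σ) * ∑ v, x j v * f v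
      ∧ ∑ j ∈ range n, σ ^ j * (1 - σ) * ∑ v, x j v * f v ≤ ∑ v, u v * f v := by
  classical
  obtain ⟨h0, hs⟩ := resolvent_remainder_nonneg_sum hK0 hK1 hσ0 hσ1 hν0 hν1 hu hx0 hxs n
  -- the discounted partial expectation is the expectation under the truncation
  have e : ∑ j ∈ range n, σ ^ j * (1 - σ) * ∑ v, x j v * f v = ∑ v, (∑ j ∈ range n, σ ^ j * (1 - σ) * x j v) * f v := by
    simp_rw [mul_sum, sum_mul]; rw [sum_comm]; exact sum_congr rfl fun v _ => sum_congr rfl fun j _ => by ring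
  rw [e]
  refine ⟨?_, ?_⟩
  · -- `E_u f − Σ_v S_n(v) f(v) = Σ_v r_n(v) f(v) ≤ Σ_v r_n(v) = σⁿ`
    have h1 : ∑ v, u v * f v - ∑ v, (∑ j ∈ range n, σ ^ j * (1 - σ) * x j v) * f v
        = ∑ v, (u v - ∑ j ∈ range n, σ ^ j * (1 - σ) * x j v) * f v := by
      rw [← sum_sub_distrib]; exact sum_congr rfl fun v _ => by ring
    have h2 : ∑ v, (u v - ∑ j ∈ range n, σ ^ j * (1 - σ) * x j v) * f v ≤ ∑ v, (u v - ∑ j ∈ range n, σ ^ j * (1 - σ) * x j v) :=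
      sum_le_sum fun v _ => mul_le_of_le_one_right (h0 v) (hf1 v)
    rw [hs] at h2
    linarith
  · exact sum_le_sum fun v _ => mul_le_mul_of_nonneg_right (by linarith [h0 v]) (hf0 v)

end ResolventPartial

end Summit.Ventures.LatticeQCDFlow.Scaling
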